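import Literature.NumberTheory.EllipticCurves.Rank1Residual.X12SexticTwistTransport
import Literature.NumberTheory.EllipticCurves.KrizLi2019.ThreeClassNumbers
import Literature.NumberTheory.EllipticCurves.HeegnerHypothesisKroneckerProofs
import Literature.NumberTheory.QuadraticFields.ClassNumberOneBakerInequality
import HarnessLib

/-!
# X12 at `p = 3`, Kriz–Li sextic-twist corner: the field-side side conditions of the seven transports, DISCHARGED IN THE KERNEL

HONEST FRAMING (cell `b2b-bsdres`, run/shared/lean/b2b/bsd-rank1-residual/; harvest seat
`b2b-bsdres-harvest-1`, gen 4): prove what is provable now; shrink each hard class to its core with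
data; no claim beyond stated classes. The cell deletes the COMBINATION-SHAPED residual classes of
the BSD formula in analytic rank `≤ 1` from PUBLISHED theorems only and TYPES the
construction-shaped ones; this is not "finishing BSD". Class X12 stays CONSTRUCTION-SHAPED; this
file is PER CURVE. THEOREMS ONLY: no definition, NO new named fact (net debt `0`).

The transports `Rank1Residual/X12SexticTwistTransport.lean` (harvest seat 2, p192605 / p192689;
record theorems `X12SexticTwist.bsdp_three_cremona{225a,1323m,1728a,3888t,7803b,11907s,15129a}`;
the primed forms of the append p192689 already drop `hμ`) carry, besides the published named facts
and the Gross–Zagier data over `K`, five FIELD-SIDE hypotheses per pair that were certificate values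
(engine-checked outside the kernel): `3 ∤ #μ(K)` (`hμ`), the Heegner hypothesis for `3|d|` (`hH`),
the Heegner hypothesis for `N` (`hHN`), and Kriz–Li's two `3`-class-number conditions (3) (`h3a`,
`h3b`). This file removes all five (it builds on the unprimed p192605 theorems and re-derives
`hμ` from `d_K < −4`, Cox §7.A, tree `BakerLimitFormula.torsionOrder_eq_two`):

* `hH`, `hHN` follow from `d_K` alone by the decomposition law in quadratic fields
  (`satisfiesHeegnerHypothesis_iff_kronecker`, Marcus Ch. 3 Thm. 25): every prime of `3dN` is one
  of two primes `a, b` with `(d_K/a) = (d_K/b) = 1` (`d_K ≡ 1 (mod 8)` at `2`), Jacobi symbols by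
  `norm_num` (`satisfiesHeegnerHypothesis_of_two_primes`);
* `h3a`, `h3b` are the kernel theorems `KrizLi2019.threeClassNumberTrivial_neg{15,55,7,987,24,184,36,276,51,136,63,123,328}`
  (`KrizLi2019/ThreeClassNumbers.lean`: `d_F = d₀`, `h_F = #`reduced forms by `decide`).

Result, per pair (`bsdp_three_cremona<N>_of_discr`): `rank(…2) = 1 ∧ BSD(…2, 3)` and
`r_an(…1) = 1 ∧ BSD(…1, 3)` from (a) the PUBLISHED named facts `thm1010_bsdThree_overK_sexticTwist`
(A48), `gross_zagier`, `kolyvagin`, `bsdTriple_of_hasCM_of_L_one_ne_zero` (BF24), `hasEntireLFunction_rat`,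
`bsdRHS_eq_of_isIsogenous`; (b) an imaginary quadratic `K` with `d_K` as listed and Kriz–Li's DATA
over it (`Dt` with `3 ∤ c`, `H`, `ι`, the Heegner point `P`); (c) THREE per-pair certificate values:
`N(…2) = N` (conductor; Cremona/PARI), side condition (i) `ord₃ Tam(twist) = ord₃ Tam(…2)`
(PARI `elllocalred`, harvest-2 j067614), and `r_an(…1) = 1` (Kriz–Li Cor. 10.7 (2); PARI). Nothing
else. Census reach if booked: 5 ‖ 7 X12 pairs (N < 10⁴ ‖ N < 2·10⁴: 225a1, 1323m1, 1728a1, 3888t1,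
7803b1 ‖ 11907s1, 15129a1); the X12 label does not change (FAMILY-shaped sub-population).

| pair | `d` | `N = aⁱbʲ` | `3·abs d` | `d_K` | (3): `h₃` of | kernel theorems used |
|---|---|---|---|---|---|---|
| 225a | `5` | `3²·5²` | `3·5` | `−11` | `−15`, `−55` | `threeClassNumberTrivial_neg15/neg55` |
| 1323m | `−7` | `3³·7²` | `3·7` | `−47` | `−7`, `−987` | `…_neg7/neg987` |
| 1728a | `8` | `2⁶·3³` | `2³·3` | `−23` | `−24`, `−184` | `…_neg24/neg184` |
| 3888t | `12` | `2⁴·3⁵` | `2²·3²` | `−23` | `−36`, `−276` | `…_neg36/neg276` |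
| 7803b | `17` | `3³·17²` | `3·17` | `−8` | `−51`, `−136` | `…_neg51/neg136` |
| 11907s | `21` | `3⁵·7²` | `3²·7` | `−47` | `−63`, `−987` | `…_neg63/neg987` |
| 15129a | `41` | `3²·41²` | `3·41` | `−8` | `−123`, `−328` | `…_neg123/neg328` |

## References
* [KrizLi2019] D. Kriz, C. Li, Forum Math. Sigma 7 (2019) e15, Thm. 1.23 = Thm. 10.10 (hypotheses (1)–(4)), Cor. 10.7.
* [Cox2013] D. A. Cox, *Primes of the form x² + ny²*, 2nd ed., §2.A, §7.B Thm. 7.7(ii).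
* [Marcus1977] D. A. Marcus, *Number Fields*, Ch. 3, Thm. 25 (decomposition of primes in quadratic fields).
* [Cremona1997] J. E. Cremona, *Algorithms for Modular Elliptic Curves*, Table 1 (the seven classes).
* Cell files: HOME/b2b-bsdres-harvest-2/KL19-X12-SEXTIC.md §3/§7; HOME/b2b-bsdres-harvest-1/RECLASSIFY.md §GEN-4.
-/

noncomputable section

open scoped Classical

open WeierstrassCurve NumberField Literature.NumberTheory.EllipticCurves
  Literature.NumberTheory.EllipticCurves.ModularForms
  Literature.NumberTheory.QuadraticFields
  Literature.NumberTheory.EllipticCurves.KrizLi2019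

namespace Literature.NumberTheory.EllipticCurves.Rank1Residual.X12SexticTwist

/-- **Heegner hypothesis for `N = aⁱ bʲ` from the decomposition law**: if `[K:ℚ] = 2`, `d_K = D`,
and the Kronecker symbol `(D/·)` is `1` at the primes `a` and `b` (`D ≡ 1 (mod 8)` at `2`), then
every prime dividing `aⁱ bʲ` splits in `K` (`satisfiesHeegnerHypothesis_iff_kronecker`; Marcus,
*Number Fields*, Ch. 3 Thm. 25). [cite: Marcus1977, Ch. 3 Thm. 25] -/
theorem satisfiesHeegnerHypothesis_of_two_primes {K : Type*} [Field K] [NumberField K]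
    (h2 : Module.finrank ℚ K = 2) {D : ℤ} (hD : NumberField.discr K = D) {a b : ℕ} (i j : ℕ)
    (ha : a.Prime) (hb : b.Prime)
    (hva : (a = 2 → D % 8 = 1) ∧ (a ≠ 2 → jacobiSym D a = 1))
    (hvb : (b = 2 → D % 8 = 1) ∧ (b ≠ 2 → jacobiSym D b = 1)) :
    SatisfiesHeegnerHypothesis (a ^ i * b ^ j) K := by
  rw [satisfiesHeegnerHypothesis_iff_kronecker _ K h2, hD]
  intro p hp hpN
  rcases (Nat.Prime.dvd_mul hp).mp hpN with h | h
  · obtain rfl := (Nat.prime_dvd_prime_iff_eq hp ha).mp (hp.dvd_of_dvd_pow h); exact hva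
  · obtain rfl := (Nat.prime_dvd_prime_iff_eq hp hb).mp (hp.dvd_of_dvd_pow h); exact hvb

/-- **`#μ(K) = 2` for a quadratic field with `d_K < −4`** (Cox §7.A; the tree's
`BakerLimitFormula.torsionOrder_eq_two` in coordinates `d_K = t² + 4m`), hence side condition (iii)
`3 ∤ #μ(K)` of the descent. [cite: Cox2013, §7.A] -/
theorem not_three_dvd_torsionOrder_of_discr_lt {K : Type*} [Field K] [NumberField K]
    (h2 : Module.finrank ℚ K = 2) (hd : NumberField.discr K < -4) : ¬ 3 ∣ Units.torsionOrder K := by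
  obtain ⟨b, hb⟩ := Quadratic.exists_basis_zero_eq_one h2
  have hω := Quadratic.basis_one_mul_self_eq b hb
  have hDK := Quadratic.discr_eq_sq_add_four_mul b hb
  rw [BakerLimitFormula.torsionOrder_eq_two b hb hω (by rw [← hDK]; exact hd)]
  decide

/-- `d_K = -11` ⇒ every prime of `15 = 3·5` splits in `K` (Jacobi symbols `= 1`). [cite: Marcus1977, Ch. 3 Thm. 25] -/
theorem heegner15_of_discr_225a {K : Type*} [Field K] [NumberField K] (h2 : Module.finrank ℚ K = 2)
    (hD : NumberField.discr K = -11) : SatisfiesHeegnerHypothesis 15 K := by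
  have h := satisfiesHeegnerHypothesis_of_two_primes h2 hD 1 1 Nat.prime_three Nat.prime_five
    ⟨by norm_num, fun _ => by norm_num⟩ ⟨by norm_num, fun _ => by norm_num⟩
  norm_num at h
  exact h

/-- `d_K = -11` ⇒ every prime of `225 = 3²·5²` splits in `K` (Jacobi symbols `= 1`). [cite: Marcus1977, Ch. 3 Thm. 25] -/
theorem heegner225_of_discr_225a {K : Type*} [Field K] [NumberField K] (h2 : Module.finrank ℚ K = 2)
    (hD : NumberField.discr K = -11) : SatisfiesHeegnerHypothesis 225 K := by
  have h := satisfiesHeegnerHypothesis_of_two_primes h2 hD 2 2 Nat.prime_three Nat.prime_five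
    ⟨by norm_num, fun _ => by norm_num⟩ ⟨by norm_num, fun _ => by norm_num⟩
  norm_num at h
  exact h

/-- `d_K = -47` ⇒ every prime of `21 = 3·7` splits in `K` (Jacobi symbols `= 1`). [cite: Marcus1977, Ch. 3 Thm. 25] -/
theorem heegner21_of_discr_1323m {K : Type*} [Field K] [NumberField K] (h2 : Module.finrank ℚ K = 2)
    (hD : NumberField.discr K = -47) : SatisfiesHeegnerHypothesis 21 K := by
  have h := satisfiesHeegnerHypothesis_of_two_primes h2 hD 1 1 Nat.prime_three (by norm_num : Nat.Prime 7)
    ⟨by norm_num, fun _ => by norm_num⟩ ⟨by norm_num, fun _ => by norm_num⟩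
  norm_num at h
  exact h

/-- `d_K = -47` ⇒ every prime of `1323 = 3³·7²` splits in `K` (Jacobi symbols `= 1`). [cite: Marcus1977, Ch. 3 Thm. 25] -/
theorem heegner1323_of_discr_1323m {K : Type*} [Field K] [NumberField K] (h2 : Module.finrank ℚ K = 2)
    (hD : NumberField.discr K = -47) : SatisfiesHeegnerHypothesis 1323 K := by
  have h := satisfiesHeegnerHypothesis_of_two_primes h2 hD 3 2 Nat.prime_three (by norm_num : Nat.Prime 7)
    ⟨by norm_num, fun _ => by norm_num⟩ ⟨by norm_num, fun _ => by norm_num⟩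
  norm_num at h
  exact h

/-- `d_K = -23` ⇒ every prime of `24 = 2³·3` splits in `K` (Jacobi symbols `= 1`). [cite: Marcus1977, Ch. 3 Thm. 25] -/
theorem heegner24_of_discr_1728a {K : Type*} [Field K] [NumberField K] (h2 : Module.finrank ℚ K = 2)
    (hD : NumberField.discr K = -23) : SatisfiesHeegnerHypothesis 24 K := by
  have h := satisfiesHeegnerHypothesis_of_two_primes h2 hD 3 1 Nat.prime_two Nat.prime_three
    ⟨fun _ => by norm_num, fun h => absurd rfl h⟩ ⟨by norm_num, fun _ => by norm_num⟩
  norm_num at h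
  exact h

/-- `d_K = -23` ⇒ every prime of `1728 = 2⁶·3³` splits in `K` (Jacobi symbols `= 1`). [cite: Marcus1977, Ch. 3 Thm. 25] -/
theorem heegner1728_of_discr_1728a {K : Type*} [Field K] [NumberField K] (h2 : Module.finrank ℚ K = 2)
    (hD : NumberField.discr K = -23) : SatisfiesHeegnerHypothesis 1728 K := by
  have h := satisfiesHeegnerHypothesis_of_two_primes h2 hD 6 3 Nat.prime_two Nat.prime_three
    ⟨fun _ => by norm_num, fun h => absurd rfl h⟩ ⟨by norm_num, fun _ => by norm_num⟩
  norm_num at h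
  exact h

/-- `d_K = -23` ⇒ every prime of `36 = 2²·3²` splits in `K` (Jacobi symbols `= 1`). [cite: Marcus1977, Ch. 3 Thm. 25] -/
theorem heegner36_of_discr_3888t {K : Type*} [Field K] [NumberField K] (h2 : Module.finrank ℚ K = 2)
    (hD : NumberField.discr K = -23) : SatisfiesHeegnerHypothesis 36 K := by
  have h := satisfiesHeegnerHypothesis_of_two_primes h2 hD 2 2 Nat.prime_two Nat.prime_three
    ⟨fun _ => by norm_num, fun h => absurd rfl h⟩ ⟨by norm_num, fun _ => by norm_num⟩
  norm_num at h
  exact h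

/-- `d_K = -23` ⇒ every prime of `3888 = 2⁴·3⁵` splits in `K` (Jacobi symbols `= 1`). [cite: Marcus1977, Ch. 3 Thm. 25] -/
theorem heegner3888_of_discr_3888t {K : Type*} [Field K] [NumberField K] (h2 : Module.finrank ℚ K = 2)
    (hD : NumberField.discr K = -23) : SatisfiesHeegnerHypothesis 3888 K := by
  have h := satisfiesHeegnerHypothesis_of_two_primes h2 hD 4 5 Nat.prime_two Nat.prime_three
    ⟨fun _ => by norm_num, fun h => absurd rfl h⟩ ⟨by norm_num, fun _ => by norm_num⟩
  norm_num at h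
  exact h

/-- `d_K = -8` ⇒ every prime of `51 = 3·17` splits in `K` (Jacobi symbols `= 1`). [cite: Marcus1977, Ch. 3 Thm. 25] -/
theorem heegner51_of_discr_7803b {K : Type*} [Field K] [NumberField K] (h2 : Module.finrank ℚ K = 2)
    (hD : NumberField.discr K = -8) : SatisfiesHeegnerHypothesis 51 K := by
  have h := satisfiesHeegnerHypothesis_of_two_primes h2 hD 1 1 Nat.prime_three (by norm_num : Nat.Prime 17)
    ⟨by norm_num, fun _ => by norm_num⟩ ⟨by norm_num, fun _ => by norm_num⟩
  norm_num at h
  exact h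

/-- `d_K = -8` ⇒ every prime of `7803 = 3³·17²` splits in `K` (Jacobi symbols `= 1`). [cite: Marcus1977, Ch. 3 Thm. 25] -/
theorem heegner7803_of_discr_7803b {K : Type*} [Field K] [NumberField K] (h2 : Module.finrank ℚ K = 2)
    (hD : NumberField.discr K = -8) : SatisfiesHeegnerHypothesis 7803 K := by
  have h := satisfiesHeegnerHypothesis_of_two_primes h2 hD 3 2 Nat.prime_three (by norm_num : Nat.Prime 17)
    ⟨by norm_num, fun _ => by norm_num⟩ ⟨by norm_num, fun _ => by norm_num⟩
  norm_num at h
  exact h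

/-- `d_K = -47` ⇒ every prime of `63 = 3²·7` splits in `K` (Jacobi symbols `= 1`). [cite: Marcus1977, Ch. 3 Thm. 25] -/
theorem heegner63_of_discr_11907s {K : Type*} [Field K] [NumberField K] (h2 : Module.finrank ℚ K = 2)
    (hD : NumberField.discr K = -47) : SatisfiesHeegnerHypothesis 63 K := by
  have h := satisfiesHeegnerHypothesis_of_two_primes h2 hD 2 1 Nat.prime_three (by norm_num : Nat.Prime 7)
    ⟨by norm_num, fun _ => by norm_num⟩ ⟨by norm_num, fun _ => by norm_num⟩
  norm_num at h
  exact h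

/-- `d_K = -47` ⇒ every prime of `11907 = 3⁵·7²` splits in `K` (Jacobi symbols `= 1`). [cite: Marcus1977, Ch. 3 Thm. 25] -/
theorem heegner11907_of_discr_11907s {K : Type*} [Field K] [NumberField K] (h2 : Module.finrank ℚ K = 2)
    (hD : NumberField.discr K = -47) : SatisfiesHeegnerHypothesis 11907 K := by
  have h := satisfiesHeegnerHypothesis_of_two_primes h2 hD 5 2 Nat.prime_three (by norm_num : Nat.Prime 7)
    ⟨by norm_num, fun _ => by norm_num⟩ ⟨by norm_num, fun _ => by norm_num⟩
  norm_num at h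
  exact h

/-- `d_K = -8` ⇒ every prime of `123 = 3·41` splits in `K` (Jacobi symbols `= 1`). [cite: Marcus1977, Ch. 3 Thm. 25] -/
theorem heegner123_of_discr_15129a {K : Type*} [Field K] [NumberField K] (h2 : Module.finrank ℚ K = 2)
    (hD : NumberField.discr K = -8) : SatisfiesHeegnerHypothesis 123 K := by
  have h := satisfiesHeegnerHypothesis_of_two_primes h2 hD 1 1 Nat.prime_three (by norm_num : Nat.Prime 41)
    ⟨by norm_num, fun _ => by norm_num⟩ ⟨by norm_num, fun _ => by norm_num⟩
  norm_num at h
  exact h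

/-- `d_K = -8` ⇒ every prime of `15129 = 3²·41²` splits in `K` (Jacobi symbols `= 1`). [cite: Marcus1977, Ch. 3 Thm. 25] -/
theorem heegner15129_of_discr_15129a {K : Type*} [Field K] [NumberField K] (h2 : Module.finrank ℚ K = 2)
    (hD : NumberField.discr K = -8) : SatisfiesHeegnerHypothesis 15129 K := by
  have h := satisfiesHeegnerHypothesis_of_two_primes h2 hD 2 2 Nat.prime_three (by norm_num : Nat.Prime 41)
    ⟨by norm_num, fun _ => by norm_num⟩ ⟨by norm_num, fun _ => by norm_num⟩
  norm_num at h
  exact h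

/-- **225a**, hypotheses reduced to the published facts + Kriz–Li's data + three certificate
values: as `bsdp_three_cremona225a'` (harvest seat 2) WITHOUT `hH`, `hHN` (Heegner for `15` and
`225`: from `d_K = -11` by the decomposition law) and WITHOUT `h3a`, `h3b` (Kriz–Li (3): kernel
theorems `threeClassNumberTrivial_neg15`, `threeClassNumberTrivial_neg55`). Remaining per-pair
certificate values: `N(225a2) = 225`, side condition (i), `r_an(225a1) = 1`.
[cite: KrizLi2019, Thm. 1.23 = Thm. 10.10] [cite: Cremona1997, Table 1 (class 225a)] -/
theorem bsdp_three_cremona225a_of_discr (K : Type) [Field K] [NumberField K]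
    (Dt : ModularParametrizationData cremona225a2 225) (H : HeegnerDatum 225 (NumberField.discr K))
    (ι : K →+* ℂ) (P : (cremona225a2.baseChange K).toAffine.Point)
    (h : thm1010_bsdThree_overK_sexticTwist) (hGZ : gross_zagier 225 cremona225a2 K)
    (hKo : kolyvagin 225 cremona225a2 K) (hCM0 : bsdTriple_of_hasCM_of_L_one_ne_zero)
    (hmod : hasEntireLFunction_rat) (hCassels : bsdRHS_eq_of_isIsogenous)
    (hK : IsImaginaryQuadratic K) (hD : NumberField.discr K = -11)
    (hP : WeierstrassCurve.Affine.Point.map ι.toRatAlgHom P = heegnerPointComplex Dt H)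
    (h4 : ¬ (3 : ℤ) ∣ Dt.c) (hN : cremona225a2.conductorNorm ℤ = 225)
    (htam : padicValNat 3 cremona225a2Tw.tamagawaProduct = padicValNat 3 cremona225a2.tamagawaProduct)
    (hr : cremona225a1.analyticRank = 1) :
    (cremona225a2.mordellWeilRank = 1 ∧ BSDp cremona225a2 3) ∧
      (cremona225a1.analyticRank = 1 ∧ BSDp cremona225a1 3) :=
  bsdp_three_cremona225a K Dt H ι P h hGZ hKo hCM0 hmod hCassels hK hD
    (heegner15_of_discr_225a hK.1 hD) (heegner225_of_discr_225a hK.1 hD) hP h4 hN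
    threeClassNumberTrivial_neg15 threeClassNumberTrivial_neg55 htam
    (not_three_dvd_torsionOrder_of_discr_lt hK.1 (by rw [hD]; norm_num)) hr

/-- **1323m**, hypotheses reduced to the published facts + Kriz–Li's data + three certificate
values: as `bsdp_three_cremona1323m'` (harvest seat 2) WITHOUT `hH`, `hHN` (Heegner for `21` and
`1323`: from `d_K = -47` by the decomposition law) and WITHOUT `h3a`, `h3b` (Kriz–Li (3): kernel
theorems `threeClassNumberTrivial_neg7`, `threeClassNumberTrivial_neg987`). Remaining per-pair
certificate values: `N(1323m2) = 1323`, side condition (i), `r_an(1323m1) = 1`.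
[cite: KrizLi2019, Thm. 1.23 = Thm. 10.10] [cite: Cremona1997, Table 1 (class 1323m)] -/
theorem bsdp_three_cremona1323m_of_discr (K : Type) [Field K] [NumberField K]
    (Dt : ModularParametrizationData cremona1323m2 1323) (H : HeegnerDatum 1323 (NumberField.discr K))
    (ι : K →+* ℂ) (P : (cremona1323m2.baseChange K).toAffine.Point)
    (h : thm1010_bsdThree_overK_sexticTwist) (hGZ : gross_zagier 1323 cremona1323m2 K)
    (hKo : kolyvagin 1323 cremona1323m2 K) (hCM0 : bsdTriple_of_hasCM_of_L_one_ne_zero)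
    (hmod : hasEntireLFunction_rat) (hCassels : bsdRHS_eq_of_isIsogenous)
    (hK : IsImaginaryQuadratic K) (hD : NumberField.discr K = -47)
    (hP : WeierstrassCurve.Affine.Point.map ι.toRatAlgHom P = heegnerPointComplex Dt H)
    (h4 : ¬ (3 : ℤ) ∣ Dt.c) (hN : cremona1323m2.conductorNorm ℤ = 1323)
    (htam : padicValNat 3 cremona1323m2Tw.tamagawaProduct = padicValNat 3 cremona1323m2.tamagawaProduct)
    (hr : cremona1323m1.analyticRank = 1) :
    (cremona1323m2.mordellWeilRank = 1 ∧ BSDp cremona1323m2 3) ∧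
      (cremona1323m1.analyticRank = 1 ∧ BSDp cremona1323m1 3) :=
  bsdp_three_cremona1323m K Dt H ι P h hGZ hKo hCM0 hmod hCassels hK hD
    (heegner21_of_discr_1323m hK.1 hD) (heegner1323_of_discr_1323m hK.1 hD) hP h4 hN
    threeClassNumberTrivial_neg7 threeClassNumberTrivial_neg987 htam
    (not_three_dvd_torsionOrder_of_discr_lt hK.1 (by rw [hD]; norm_num)) hr

/-- **1728a**, hypotheses reduced to the published facts + Kriz–Li's data + three certificate
values: as `bsdp_three_cremona1728a'` (harvest seat 2) WITHOUT `hH`, `hHN` (Heegner for `24` and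
`1728`: from `d_K = -23` by the decomposition law) and WITHOUT `h3a`, `h3b` (Kriz–Li (3): kernel
theorems `threeClassNumberTrivial_neg24`, `threeClassNumberTrivial_neg184`). Remaining per-pair
certificate values: `N(1728a2) = 1728`, side condition (i), `r_an(1728a1) = 1`.
[cite: KrizLi2019, Thm. 1.23 = Thm. 10.10] [cite: Cremona1997, Table 1 (class 1728a)] -/
theorem bsdp_three_cremona1728a_of_discr (K : Type) [Field K] [NumberField K]
    (Dt : ModularParametrizationData cremona1728a2 1728) (H : HeegnerDatum 1728 (NumberField.discr K))
    (ι : K →+* ℂ) (P : (cremona1728a2.baseChange K).toAffine.Point)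
    (h : thm1010_bsdThree_overK_sexticTwist) (hGZ : gross_zagier 1728 cremona1728a2 K)
    (hKo : kolyvagin 1728 cremona1728a2 K) (hCM0 : bsdTriple_of_hasCM_of_L_one_ne_zero)
    (hmod : hasEntireLFunction_rat) (hCassels : bsdRHS_eq_of_isIsogenous)
    (hK : IsImaginaryQuadratic K) (hD : NumberField.discr K = -23)
    (hP : WeierstrassCurve.Affine.Point.map ι.toRatAlgHom P = heegnerPointComplex Dt H)
    (h4 : ¬ (3 : ℤ) ∣ Dt.c) (hN : cremona1728a2.conductorNorm ℤ = 1728)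
    (htam : padicValNat 3 cremona1728a2Tw.tamagawaProduct = padicValNat 3 cremona1728a2.tamagawaProduct)
    (hr : cremona1728a1.analyticRank = 1) :
    (cremona1728a2.mordellWeilRank = 1 ∧ BSDp cremona1728a2 3) ∧
      (cremona1728a1.analyticRank = 1 ∧ BSDp cremona1728a1 3) :=
  bsdp_three_cremona1728a K Dt H ι P h hGZ hKo hCM0 hmod hCassels hK hD
    (heegner24_of_discr_1728a hK.1 hD) (heegner1728_of_discr_1728a hK.1 hD) hP h4 hN
    threeClassNumberTrivial_neg24 threeClassNumberTrivial_neg184 htam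
    (not_three_dvd_torsionOrder_of_discr_lt hK.1 (by rw [hD]; norm_num)) hr

/-- **3888t**, hypotheses reduced to the published facts + Kriz–Li's data + three certificate
values: as `bsdp_three_cremona3888t'` (harvest seat 2) WITHOUT `hH`, `hHN` (Heegner for `36` and
`3888`: from `d_K = -23` by the decomposition law) and WITHOUT `h3a`, `h3b` (Kriz–Li (3): kernel
theorems `threeClassNumberTrivial_neg36`, `threeClassNumberTrivial_neg276`). Remaining per-pair
certificate values: `N(3888t2) = 3888`, side condition (i), `r_an(3888t1) = 1`.
[cite: KrizLi2019, Thm. 1.23 = Thm. 10.10] [cite: Cremona1997, Table 1 (class 3888t)] -/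
theorem bsdp_three_cremona3888t_of_discr (K : Type) [Field K] [NumberField K]
    (Dt : ModularParametrizationData cremona3888t2 3888) (H : HeegnerDatum 3888 (NumberField.discr K))
    (ι : K →+* ℂ) (P : (cremona3888t2.baseChange K).toAffine.Point)
    (h : thm1010_bsdThree_overK_sexticTwist) (hGZ : gross_zagier 3888 cremona3888t2 K)
    (hKo : kolyvagin 3888 cremona3888t2 K) (hCM0 : bsdTriple_of_hasCM_of_L_one_ne_zero)
    (hmod : hasEntireLFunction_rat) (hCassels : bsdRHS_eq_of_isIsogenous)
    (hK : IsImaginaryQuadratic K) (hD : NumberField.discr K = -23)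
    (hP : WeierstrassCurve.Affine.Point.map ι.toRatAlgHom P = heegnerPointComplex Dt H)
    (h4 : ¬ (3 : ℤ) ∣ Dt.c) (hN : cremona3888t2.conductorNorm ℤ = 3888)
    (htam : padicValNat 3 cremona3888t2Tw.tamagawaProduct = padicValNat 3 cremona3888t2.tamagawaProduct)
    (hr : cremona3888t1.analyticRank = 1) :
    (cremona3888t2.mordellWeilRank = 1 ∧ BSDp cremona3888t2 3) ∧
      (cremona3888t1.analyticRank = 1 ∧ BSDp cremona3888t1 3) :=
  bsdp_three_cremona3888t K Dt H ι P h hGZ hKo hCM0 hmod hCassels hK hD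
    (heegner36_of_discr_3888t hK.1 hD) (heegner3888_of_discr_3888t hK.1 hD) hP h4 hN
    threeClassNumberTrivial_neg36 threeClassNumberTrivial_neg276 htam
    (not_three_dvd_torsionOrder_of_discr_lt hK.1 (by rw [hD]; norm_num)) hr

/-- **7803b**, hypotheses reduced to the published facts + Kriz–Li's data + three certificate
values: as `bsdp_three_cremona7803b'` (harvest seat 2) WITHOUT `hH`, `hHN` (Heegner for `51` and
`7803`: from `d_K = -8` by the decomposition law) and WITHOUT `h3a`, `h3b` (Kriz–Li (3): kernel
theorems `threeClassNumberTrivial_neg51`, `threeClassNumberTrivial_neg136`). Remaining per-pair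
certificate values: `N(7803b2) = 7803`, side condition (i), `r_an(7803b1) = 1`.
[cite: KrizLi2019, Thm. 1.23 = Thm. 10.10] [cite: Cremona1997, Table 1 (class 7803b)] -/
theorem bsdp_three_cremona7803b_of_discr (K : Type) [Field K] [NumberField K]
    (Dt : ModularParametrizationData cremona7803b2 7803) (H : HeegnerDatum 7803 (NumberField.discr K))
    (ι : K →+* ℂ) (P : (cremona7803b2.baseChange K).toAffine.Point)
    (h : thm1010_bsdThree_overK_sexticTwist) (hGZ : gross_zagier 7803 cremona7803b2 K)
    (hKo : kolyvagin 7803 cremona7803b2 K) (hCM0 : bsdTriple_of_hasCM_of_L_one_ne_zero)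
    (hmod : hasEntireLFunction_rat) (hCassels : bsdRHS_eq_of_isIsogenous)
    (hK : IsImaginaryQuadratic K) (hD : NumberField.discr K = -8)
    (hP : WeierstrassCurve.Affine.Point.map ι.toRatAlgHom P = heegnerPointComplex Dt H)
    (h4 : ¬ (3 : ℤ) ∣ Dt.c) (hN : cremona7803b2.conductorNorm ℤ = 7803)
    (htam : padicValNat 3 cremona7803b2Tw.tamagawaProduct = padicValNat 3 cremona7803b2.tamagawaProduct)
    (hr : cremona7803b1.analyticRank = 1) :
    (cremona7803b2.mordellWeilRank = 1 ∧ BSDp cremona7803b2 3) ∧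
      (cremona7803b1.analyticRank = 1 ∧ BSDp cremona7803b1 3) :=
  bsdp_three_cremona7803b K Dt H ι P h hGZ hKo hCM0 hmod hCassels hK hD
    (heegner51_of_discr_7803b hK.1 hD) (heegner7803_of_discr_7803b hK.1 hD) hP h4 hN
    threeClassNumberTrivial_neg51 threeClassNumberTrivial_neg136 htam
    (not_three_dvd_torsionOrder_of_discr_lt hK.1 (by rw [hD]; norm_num)) hr

/-- **11907s**, hypotheses reduced to the published facts + Kriz–Li's data + three certificate
values: as `bsdp_three_cremona11907s'` (harvest seat 2) WITHOUT `hH`, `hHN` (Heegner for `63` and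
`11907`: from `d_K = -47` by the decomposition law) and WITHOUT `h3a`, `h3b` (Kriz–Li (3): kernel
theorems `threeClassNumberTrivial_neg63`, `threeClassNumberTrivial_neg987`). Remaining per-pair
certificate values: `N(11907s2) = 11907`, side condition (i), `r_an(11907s1) = 1`.
[cite: KrizLi2019, Thm. 1.23 = Thm. 10.10] [cite: Cremona1997, Table 1 (class 11907s)] -/
theorem bsdp_three_cremona11907s_of_discr (K : Type) [Field K] [NumberField K]
    (Dt : ModularParametrizationData cremona11907s2 11907) (H : HeegnerDatum 11907 (NumberField.discr K))
    (ι : K →+* ℂ) (P : (cremona11907s2.baseChange K).toAffine.Point)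
    (h : thm1010_bsdThree_overK_sexticTwist) (hGZ : gross_zagier 11907 cremona11907s2 K)
    (hKo : kolyvagin 11907 cremona11907s2 K) (hCM0 : bsdTriple_of_hasCM_of_L_one_ne_zero)
    (hmod : hasEntireLFunction_rat) (hCassels : bsdRHS_eq_of_isIsogenous)
    (hK : IsImaginaryQuadratic K) (hD : NumberField.discr K = -47)
    (hP : WeierstrassCurve.Affine.Point.map ι.toRatAlgHom P = heegnerPointComplex Dt H)
    (h4 : ¬ (3 : ℤ) ∣ Dt.c) (hN : cremona11907s2.conductorNorm ℤ = 11907)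
    (htam : padicValNat 3 cremona11907s2Tw.tamagawaProduct = padicValNat 3 cremona11907s2.tamagawaProduct)
    (hr : cremona11907s1.analyticRank = 1) :
    (cremona11907s2.mordellWeilRank = 1 ∧ BSDp cremona11907s2 3) ∧
      (cremona11907s1.analyticRank = 1 ∧ BSDp cremona11907s1 3) :=
  bsdp_three_cremona11907s K Dt H ι P h hGZ hKo hCM0 hmod hCassels hK hD
    (heegner63_of_discr_11907s hK.1 hD) (heegner11907_of_discr_11907s hK.1 hD) hP h4 hN
    threeClassNumberTrivial_neg63 threeClassNumberTrivial_neg987 htam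
    (not_three_dvd_torsionOrder_of_discr_lt hK.1 (by rw [hD]; norm_num)) hr

/-- **15129a**, hypotheses reduced to the published facts + Kriz–Li's data + three certificate
values: as `bsdp_three_cremona15129a'` (harvest seat 2) WITHOUT `hH`, `hHN` (Heegner for `123` and
`15129`: from `d_K = -8` by the decomposition law) and WITHOUT `h3a`, `h3b` (Kriz–Li (3): kernel
theorems `threeClassNumberTrivial_neg123`, `threeClassNumberTrivial_neg328`). Remaining per-pair
certificate values: `N(15129a2) = 15129`, side condition (i), `r_an(15129a1) = 1`.
[cite: KrizLi2019, Thm. 1.23 = Thm. 10.10] [cite: Cremona1997, Table 1 (class 15129a)] -/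
theorem bsdp_three_cremona15129a_of_discr (K : Type) [Field K] [NumberField K]
    (Dt : ModularParametrizationData cremona15129a2 15129) (H : HeegnerDatum 15129 (NumberField.discr K))
    (ι : K →+* ℂ) (P : (cremona15129a2.baseChange K).toAffine.Point)
    (h : thm1010_bsdThree_overK_sexticTwist) (hGZ : gross_zagier 15129 cremona15129a2 K)
    (hKo : kolyvagin 15129 cremona15129a2 K) (hCM0 : bsdTriple_of_hasCM_of_L_one_ne_zero)
    (hmod : hasEntireLFunction_rat) (hCassels : bsdRHS_eq_of_isIsogenous)
    (hK : IsImaginaryQuadratic K) (hD : NumberField.discr K = -8)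
    (hP : WeierstrassCurve.Affine.Point.map ι.toRatAlgHom P = heegnerPointComplex Dt H)
    (h4 : ¬ (3 : ℤ) ∣ Dt.c) (hN : cremona15129a2.conductorNorm ℤ = 15129)
    (htam : padicValNat 3 cremona15129a2Tw.tamagawaProduct = padicValNat 3 cremona15129a2.tamagawaProduct)
    (hr : cremona15129a1.analyticRank = 1) :
    (cremona15129a2.mordellWeilRank = 1 ∧ BSDp cremona15129a2 3) ∧
      (cremona15129a1.analyticRank = 1 ∧ BSDp cremona15129a1 3) :=
  bsdp_three_cremona15129a K Dt H ι P h hGZ hKo hCM0 hmod hCassels hK hD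
    (heegner123_of_discr_15129a hK.1 hD) (heegner15129_of_discr_15129a hK.1 hD) hP h4 hN
    threeClassNumberTrivial_neg123 threeClassNumberTrivial_neg328 htam
    (not_three_dvd_torsionOrder_of_discr_lt hK.1 (by rw [hD]; norm_num)) hr

end Literature.NumberTheory.EllipticCurves.Rank1Residual.X12SexticTwist

end
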